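import Summits.CriticalPhenomena.PercolationContinuityZ3.Theses.PercNonProliferation
import Summits.CriticalPhenomena.PercolationContinuityZ3.Theorems.NonProliferation.Negative.AboveSix
import Summits.CriticalPhenomena.PercolationContinuityZ3.Theorems.PercNonProliferationNonProliferationStubBoundaryGrid
import Summits.CriticalPhenomena.PercolationContinuityZ3.Theorems.PercNonProliferationNonProliferationStubMidSphereCrossers
import Summits.CriticalPhenomena.PercolationContinuityZ3.Theorems.PercNonProliferationNonProliferationStubMultiCrossAtShift
import Literature.Probability.Percolation.RSW
import HarnessLib

/-!
# Crux `PercNonProliferation.NonProliferation` (stmt-CriticalPhenomena-4444), line `boundary-pinning` —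
# calibration of the BULK sibling: the three-crosser stub is dimension-sensitive (its `d`-dimensional analogue
# fails above six)

Lead's calibration file (prover-line-stmt-CriticalPhenomena-4444-c1; skeleton
`Cruxes/NonProliferation/Lines/boundary_pinning.lean`). Lands with `--supports stmt-CriticalPhenomena-4444`; closes nothing.

The bulk open stub `stub_threeCrosserDecay` asks, at `p_c(ℤ³)`, that three box-distinct crossers of the annulus
`B(km) ∖ B(m)` have probability `o(k⁻²)` (some ratio `k`, eventually in `m`). Its `d`-dimensional analogue replaces
`k²` by `k^{d-1}` (the mid-sphere is `(d-1)`-dimensional, covered by `≍ k^{d-1}` translates of `B(m)`). The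
dimension-free bookkeeping (`stub_boundaryGrid`, `stub_midSphereCrossers`, `stub_multiCrossAt_shift`, all landed and
valid in every `d`) turns the analogue into the `d`-dimensional crux (`nonProliferationDim_of_threeCrosserDecayDim`),
which is FALSE for `d ≥ 7` under Aizenman's (t-c) with `η = 0` (`Negative.nonProliferation_false_of_twoPointBoundedRatio`);
hence so is the analogue (`threeCrosserDecayDim_false_above_six`): the stub, not the bookkeeping, carries the `d = 3`
content, as `Negative.nonProliferation_false_without_dimThree` demands.
-/

noncomputable section

namespace Summit.CriticalPhenomena.PercolationContinuityZ3.Theorems.NonProliferation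

open MeasureTheory Filter Topology
open Literature.Probability.LatticeModels Literature.Probability.Percolation
open Literature.Barriers.CriticalPhenomena
open Summit.CriticalPhenomena.PercolationContinuityZ3.Theorems.NonProliferation.Negative

namespace BulkCoveringCalibration

/-- Arithmetic of the bulk covering in dimension `d`: with `k ≥ 2`, `m ≥ 1`, `2km + 2 ≤ n ≤ 2k(m+1) + 2`, the
grid of `stub_boundaryGrid` on `∂ⁱⁿB(n + km + 1)` with cell side `m + 1` has `≤ 2d (11k)^{d-1}` cells. -/
theorem count_le_dim (d : ℕ) {n k m : ℕ} (hk : 2 ≤ k) (hm1 : 1 ≤ m) (h2km : 2 * k * m + 2 ≤ n)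
    (hn : n ≤ 2 * k * (m + 1) + 2) :
    2 * (d : ℝ) * (2 * ((n + k * m + 1 : ℕ) : ℝ) / ((m + 1 : ℕ) : ℝ) + 2) ^ (d - 1) ≤
      2 * d * (11 * (k : ℝ)) ^ (d - 1) := by
  have hM : (0 : ℝ) < ((m + 1 : ℕ) : ℝ) := by positivity
  have hk' : (2 : ℝ) ≤ k := by exact_mod_cast hk
  have hm' : (1 : ℝ) ≤ m := by exact_mod_cast hm1
  have h1 : (2 * k * m + 2 : ℝ) ≤ n := by exact_mod_cast h2km
  have h2 : (n : ℝ) ≤ 2 * k * (m + 1) + 2 := by exact_mod_cast hn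
  have hbase : 2 * ((n + k * m + 1 : ℕ) : ℝ) / ((m + 1 : ℕ) : ℝ) ≤ 6 * k + 3 := by
    rw [div_le_iff₀ hM]; push_cast; nlinarith
  have h0 : (0 : ℝ) ≤ 2 * ((n + k * m + 1 : ℕ) : ℝ) / ((m + 1 : ℕ) : ℝ) + 2 := by positivity
  have hb2 : 2 * ((n + k * m + 1 : ℕ) : ℝ) / ((m + 1 : ℕ) : ℝ) + 2 ≤ 11 * k := by linarith
  gcongr

end BulkCoveringCalibration

/-- **The bulk bookkeeping in every dimension `d`.** If for every `η > 0` there is a ratio `k ≥ 2` such that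
for all large `m` three points of `B(m) ⊆ ℤ^d`, each joined inside `B(km)` to `∂ⁱⁿB(km)`, pairwise not joined
inside `B(km)`, occur with `P_{p_c(ℤ^d)}`-probability `≤ η / k^{d-1}`, then the `d`-dimensional crux
`∃ M c, 0 < c ∧ ∃ᶠ n, c ≤ P_{p_c(ℤ^d)}((repEvent d M n)ᶜ)` holds (`η := 1/(2K+2)`, `K := 2d·11^{d-1}`,
`M := 2·2d(11k)^{d-1}`, `c = 1/2`; grid `stub_boundaryGrid`, `stub_midSphereCrossers`, `stub_multiCrossAt_shift`).
At `d = 3` the hypothesis is the bulk stub `stub_threeCrosserDecay` (with `k^{3-1} = k²`). -/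
theorem nonProliferationDim_of_threeCrosserDecayDim :
    ∀ d : ℕ, (∀ η : ℝ, 0 < η → ∃ k : ℕ, 2 ≤ k ∧ ∃ m₀ : ℕ, ∀ m : ℕ, m₀ ≤ m →
      (k : ℝ) ^ (d - 1) * (bondPercolation (zdGraph d) (criticalProbI d)).real
        {ω | ∃ x : Fin (2 + 1) → Site d, (∀ i, x i ∈ box d m) ∧
          (∀ i, ∃ y ∈ innerBoundary (zdGraph d) (box d (k * m)),
            ω ∈ openConnIn (↑(box d (k * m)) : Set (Site d)) (x i) y) ∧
          ∀ i j, i ≠ j → ω ∉ openConnIn (↑(box d (k * m)) : Set (Site d)) (x i) (x j)} ≤ η) →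
    ∃ (M : ℕ) (c : ℝ), 0 < c ∧ ∃ᶠ n : ℕ in atTop,
      c ≤ (bondPercolation (zdGraph d) (criticalProbI d)).real (repEvent d M n)ᶜ := by
  intro d hB3
  classical
  set μ : Measure (BondConfig (Site d)) := bondPercolation (zdGraph d) (criticalProbI d) with hμ
  set K : ℝ := 2 * d * 11 ^ (d - 1) with hK
  have hK0 : 0 ≤ K := by positivity
  have hη0 : (0 : ℝ) < 1 / (2 * K + 2) := by positivity
  obtain ⟨k, hk, m₀, hdec⟩ := hB3 (1 / (2 * K + 2)) hη0
  refine ⟨2 * (2 * d * (11 * k) ^ (d - 1)), 1 / 2, by norm_num, Eventually.frequently ?_⟩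
  filter_upwards [eventually_ge_atTop (2 * k * (m₀ + 1) + 2)] with n hn
  -- scales
  have hk0 : 0 < 2 * k := by omega
  set m : ℕ := (n - 2) / (2 * k) with hm
  have hm₀ : m₀ + 1 ≤ m := by
    rw [hm, Nat.le_div_iff_mul_le hk0]
    have : 2 * k * (m₀ + 1) = (m₀ + 1) * (2 * k) := by ring
    omega
  have hm1 : 1 ≤ m := le_trans (by omega) hm₀
  have hmm₀ : m₀ ≤ m := by omega
  have h2km : 2 * k * m + 2 ≤ n := by
    have h := Nat.div_mul_le_self (n - 2) (2 * k)
    rw [← hm] at h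
    have : 2 * k * m = m * (2 * k) := by ring
    omega
  have hn' : n ≤ 2 * k * (m + 1) + 2 := by
    have h := Nat.lt_div_mul_add hk0 (a := n - 2)
    rw [← hm] at h
    have : 2 * k * (m + 1) = m * (2 * k) + 2 * k := by ring
    omega
  -- the translated / centred three-crosser events
  set At : Site d → Set (BondConfig (Site d)) := fun z =>
    {ω | ∃ x : Fin (2 + 1) → Site d, (∀ i, x i ∈ GM.ball z m) ∧
      (∀ i, ∃ y ∈ innerBoundary (zdGraph d) (GM.ball z (k * m)),
        ω ∈ openConnIn (↑(GM.ball z (k * m)) : Set (Site d)) (x i) y) ∧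
      ∀ i j, i ≠ j → ω ∉ openConnIn (↑(GM.ball z (k * m)) : Set (Site d)) (x i) (x j)} with hAt
  set A0 : Set (BondConfig (Site d)) :=
    {ω | ∃ x : Fin (2 + 1) → Site d, (∀ i, x i ∈ box d m) ∧
      (∀ i, ∃ y ∈ innerBoundary (zdGraph d) (box d (k * m)),
        ω ∈ openConnIn (↑(box d (k * m)) : Set (Site d)) (x i) y) ∧
      ∀ i j, i ≠ j → ω ∉ openConnIn (↑(box d (k * m)) : Set (Site d)) (x i) (x j)} with hA0
  -- grid on the mid-sphere, non-empty cells, chosen points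
  obtain ⟨𝒬, hsub, hdiam, -, hcov, hcount⟩ := stub_boundaryGrid d (n + k * m + 1) (m + 1) (by omega)
  set 𝒬' : Finset (Finset (Site d)) := 𝒬.filter (fun Q => Q.Nonempty) with h𝒬'
  set z : Finset (Site d) → Site d := fun Q => if h : Q.Nonempty then h.choose else 0 with hz
  have hz_mem : ∀ Q ∈ 𝒬', z Q ∈ Q := by
    intro Q hQ
    have hne : Q.Nonempty := (Finset.mem_filter.1 hQ).2
    simp only [hz, dif_pos hne]
    exact hne.choose_spec
  have hsub' : ∀ Q ∈ 𝒬', Q ⊆ innerBoundary (zdGraph d) (box d (n + k * m + 1)) :=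
    fun Q hQ => hsub Q (Finset.mem_filter.1 hQ).1
  have hdiam' : ∀ Q ∈ 𝒬', ∀ u ∈ Q, ∀ v ∈ Q, ∀ i : Fin d, |u i - v i| ≤ (m : ℤ) := by
    intro Q hQ u hu v hv i
    have h := hdiam Q (Finset.mem_filter.1 hQ).1 u hu v hv i
    push_cast at h
    linarith
  have hcov' : ∀ y ∈ innerBoundary (zdGraph d) (box d (n + k * m + 1)), ∃ Q ∈ 𝒬', y ∈ Q := by
    intro y hy
    obtain ⟨Q, hQ, hyQ⟩ := hcov y hy
    exact ⟨Q, Finset.mem_filter.2 ⟨hQ, ⟨y, hyQ⟩⟩, hyQ⟩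
  have hcard' : (𝒬'.card : ℝ) ≤ 2 * d * (11 * (k : ℝ)) ^ (d - 1) := by
    have h1 : (𝒬'.card : ℝ) ≤ 𝒬.card := by exact_mod_cast Finset.card_filter_le _ _
    have h2 : (𝒬.card : ℝ) ≤
        2 * (d : ℝ) * (2 * ((n + k * m + 1 : ℕ) : ℝ) / ((m + 1 : ℕ) : ℝ) + 2) ^ (d - 1) := by
      exact_mod_cast hcount
    exact h1.trans (h2.trans (BulkCoveringCalibration.count_le_dim d hk hm1 h2km hn'))
  have hcardN : 𝒬'.card ≤ 2 * d * (11 * k) ^ (d - 1) := by exact_mod_cast hcard'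
  have hcardK : (𝒬'.card : ℝ) ≤ K * (k : ℝ) ^ (d - 1) := by
    rw [hK]; calc (𝒬'.card : ℝ) ≤ 2 * d * (11 * (k : ℝ)) ^ (d - 1) := hcard'
      _ = 2 * d * 11 ^ (d - 1) * (k : ℝ) ^ (d - 1) := by rw [mul_pow]; ring
  -- three crossers through one cell (a.e.), union bound, translation, decay
  have hincl : ∀ᵐ ω ∂μ, ω ∈ repEvent d (2 * 𝒬'.card) n → ω ∈ ⋃ Q ∈ 𝒬', At (z Q) := by
    filter_upwards [ae_subset_edgeSet (zdGraph d) (criticalProbI d)] with ω hω hrep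
    obtain ⟨Q, hQ, x, hx⟩ :=
      stub_midSphereCrossers d n k m 2 𝒬' z ω hm1 (by omega) h2km hω hsub' hz_mem hdiam' hcov' hrep
    exact Set.mem_biUnion hQ ⟨x, hx⟩
  have hP0 : (k : ℝ) ^ (d - 1) * μ.real A0 ≤ 1 / (2 * K + 2) := hdec m hmm₀
  have hunion : μ.real (repEvent d (2 * 𝒬'.card) n) ≤ 1 / 2 := by
    calc μ.real (repEvent d (2 * 𝒬'.card) n)
        ≤ μ.real (⋃ Q ∈ 𝒬', At (z Q)) := by
          simp only [measureReal_def]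
          exact ENNReal.toReal_mono (measure_ne_top _ _) (measure_mono_ae hincl)
      _ ≤ ∑ Q ∈ 𝒬', μ.real (At (z Q)) := measureReal_biUnion_finset_le _ _
      _ = ∑ Q ∈ 𝒬', μ.real A0 :=
          Finset.sum_congr rfl fun Q _ => stub_multiCrossAt_shift d 2 m (k * m) (criticalProbI d) (z Q)
      _ = 𝒬'.card * μ.real A0 := by rw [Finset.sum_const, nsmul_eq_mul]
      _ ≤ K * (k : ℝ) ^ (d - 1) * μ.real A0 := by gcongr
      _ = K * ((k : ℝ) ^ (d - 1) * μ.real A0) := by ring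
      _ ≤ K * (1 / (2 * K + 2)) := by gcongr
      _ = K / (2 * K + 2) := by ring
      _ ≤ 1 / 2 := by rw [div_le_iff₀ (by positivity)]; linarith
  have hM : 2 * 𝒬'.card ≤ 2 * (2 * d * (11 * k) ^ (d - 1)) := by omega
  have hmono : μ.real (repEvent d (2 * (2 * d * (11 * k) ^ (d - 1))) n) ≤ μ.real (repEvent d (2 * 𝒬'.card) n) :=
    measureReal_mono (repEvent_antitone d n hM) (measure_ne_top _ _)
  rw [probReal_compl_eq_one_sub (measurableSet_repEvent d _ n)]
  linarith

/-- **Calibration: the bulk open stub fails above six dimensions.** For every `d ≥ 7` satisfying Aizenman's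
two-point condition (t-c) with `η = 0`, the `d`-dimensional analogue of `stub_threeCrosserDecay` (three-crosser decay
`o(k^{-(d-1)})` at some ratio, eventually in `m`) is FALSE, by `Negative.nonProliferation_false_of_twoPointBoundedRatio`
(annulus-spanning box-clusters proliferate above six dimensions; proved barrier `SpanningClustersAboveSix`). -/
theorem threeCrosserDecayDim_false_above_six {d : ℕ} [NeZero d] (hd : 6 < d) (hτ : TwoPointBoundedRatio d) :
    ¬ ∀ η : ℝ, 0 < η → ∃ k : ℕ, 2 ≤ k ∧ ∃ m₀ : ℕ, ∀ m : ℕ, m₀ ≤ m →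
      (k : ℝ) ^ (d - 1) * (bondPercolation (zdGraph d) (criticalProbI d)).real
        {ω | ∃ x : Fin (2 + 1) → Site d, (∀ i, x i ∈ box d m) ∧
          (∀ i, ∃ y ∈ innerBoundary (zdGraph d) (box d (k * m)),
            ω ∈ openConnIn (↑(box d (k * m)) : Set (Site d)) (x i) y) ∧
          ∀ i j, i ≠ j → ω ∉ openConnIn (↑(box d (k * m)) : Set (Site d)) (x i) (x j)} ≤ η :=
  fun h => nonProliferation_false_of_twoPointBoundedRatio hd hτ
    (nonProliferationDim_of_threeCrosserDecayDim d h)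

end Summit.CriticalPhenomena.PercolationContinuityZ3.Theorems.NonProliferation

end
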